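import Summits.HodgeConjecture.HodgeConjecture.Theorems.MarkmanPartnerTransportRMSpreadDefs
import Summits.HodgeConjecture.HodgeConjecture.Theorems.MarkmanPartnerTransportPicardThreeK3SquaresAlgebraicLocusSpreadSection
import Literature.AlgebraicGeometry.Surfaces.K3RealMultiplicationExistence
import Literature.AlgebraicGeometry.HodgeTheory.InvariantClassesFromTotalSpaceHolds

/-!
# Route MarkmanPartnerTransport · crux `PicardThreeK3Squares` (stmt-HodgeConjecture-19652) —
# a spread family makes the real-multiplication generator cycle-induced (line «maximal-family spread»,
# final kernel shape)

Consumer of the input structure `RMSpreadFamily S hS t` (`Theorems/MarkmanPartnerTransportRMSpreadDefs`):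
a smooth projective family through `S ⊗ S` over a smooth irreducible quasi-projective base, the
endomorphism `t` of `H²(S)` as the value at that fibre of a FLAT section of `R⁴`, and a dominant
cycle-carrying classifying morphism. Everything modulo ONE named fact, Deligne's theorem of the fixed part
in Voisin's form (`deligne1968_invariantClass_fromTotalSpace`, Voisin II Thm. 4.18), which turns the flat
section into the restriction of a class of the total space; the spread itself is the tree's PROVED
structure theorem of algebraicity loci + Baire (`…AlgebraicLocusSpread{,Section}`, stub F3 of the crux).

* `RMSpreadFamily.exists_algebraicClass` — the value of the flat section at the fibre `S ⊗ S` is an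
  ALGEBRAIC class, so `t` is induced by an algebraic class on `S × S`;
* `RMSpreadFamily.isCycleInducedTranscendentalEndomorphism` — for `t` rational, type-preserving, killing
  `N¹` with image `⊥ N¹`: `t` is a cycle-induced transcendental endomorphism in van Geemen–Schütt's sense
  (`IsCycleInducedTranscendentalEndomorphism`, the shape of the tree's six vGS facts) — «a spread family
  turns real multiplication into CYCLE-INDUCED real multiplication»;
* `RMSpreadFamily.hodgeConjectureFor_square` — with `TranscendentalEndomorphismsGeneratedBy S t`: the
  Hodge conjecture for `S ⊗ S` (F4 `SquareOfGenerator.squareOfGenerator`);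
* `isCycleInducedRMK3_of_isRealMultiplicationK3_of_spreadFamilies`,
  `hodgeConjectureFor_square_of_isRealMultiplicationK3_of_spreadFamilies` — for a K3 surface with real
  multiplication by `ℚ[X]/(P)` (`IsRealMultiplicationK3 S ρ P`, van Geemen–Schütt §2.1) ALL of whose
  generators admit spread families: it is an `IsCycleInducedRMK3 S ρ P` and its square satisfies the
  Hodge conjecture. This is the INDEX row «RM-SPREAD» in closed form: RM third of the crux at `S` ⟸
  {`deligne1968_invariantClass_fromTotalSpace`, a spread family for `(S, t)`} — the latter = (I1′) universal
  RM family with flat generator + (I2) a dominating cycle-carrying family (vGS's maximal families).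

No definition, no sorry; prover seat hodge-nonav-19652-p1 (gen 7), `--supports stmt-HodgeConjecture-19652`.
Nothing here proves the crux or the Hodge conjecture; `RMSpreadFamily` is not claimed inhabited.

References: van Geemen–Schütt, Forum Math. Sigma 13 (2025) e2, §2.1, §3.4, Thm. 1.1 (9), §4.8; Voisin,
*Hodge Theory II* (2003), Thm. 4.18, §7.3.2; Varesco, Math. Z. 305 (2023), §2.
-/

set_option linter.dupNamespace false

noncomputable section

namespace Summit.HodgeConjecture.HodgeConjecture.Theorems.MarkmanPartnerTransport

open CategoryTheory MonoidalCategory CartesianMonoidalCategory AlgebraicGeometry Polynomial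
open Literature.AlgebraicGeometry Literature.AlgebraicGeometry.Motives Literature.AlgebraicGeometry.HodgeTheory
open Literature.AlgebraicGeometry.Surfaces
open Literature.AlgebraicTopology.SingularHomology

variable {S : SchemeOver ℂ} {hS : IsSmoothProjective 2 S}
  {t : complexBetti S (2 * 1) →ₗ[ℂ] complexBetti S (2 * 1)}

namespace RMSpreadFamily

/-- **The value of the flat section at the fibre `S ⊗ S` is algebraic, hence `t` is induced by an
algebraic class on `S × S`** (granted Voisin II Thm. 4.18): the section is algebraic over the image of
the dominant `classify`, so everywhere (`forall_cls_mem_algebraicClasses_of_denseRange_of_section`), in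
particular at `pt₁`; transport along `fibreIso` (`map_mem_algebraicClasses_of_isIso`).
[cite: VoisinHodgeII2003, Thm. 4.18 and §7.3.2] [cite: GeemenSchutt2023, §4.8] -/
theorem exists_algebraicClass (hD : deligne1968_invariantClass_fromTotalSpace)
    (F : RMSpreadFamily S hS t) :
    ∃ γ ∈ algebraicClasses (S ⊗ S) 2, ∀ y : complexBetti S (2 * 1),
      t y = complexGysin complexOrientationFamily (IsSmoothProjective.tensor_holds hS hS) hS
        (SemiCartesianMonoidalCategory.fst S S) (rfl : 2 * 1 + 2 * 2 + 2 * 2 = 2 * 1 + 2 * (2 + 2))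
        (cupProduct (rfl : 2 * 1 + 2 * 2 = 2 * 1 + 2 * 2)
          (complexBetti.map (SemiCartesianMonoidalCategory.snd S S) (2 * 1) y) γ) := by
  haveI := F.base_irreducible
  haveI := F.param_irreducible
  haveI := F.param_isSeparated
  haveI := F.param_locallyOfFiniteType
  haveI := F.param_nonempty
  refine ⟨complexBetti.map F.fibreIso.hom (2 * 2) ((F.flatSection F.pt₁).clsAt (F.flatSection_pt F.pt₁)),
    map_mem_algebraicClasses_of_isIso F.fibreIso.hom ?_, F.induces⟩
  exact AlgebraicLocusSpread.forall_cls_mem_algebraicClasses_of_denseRange_of_section hD F.family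
    F.isSmoothProjectiveFamily F.total_quasiProjective F.base_quasiProjective F.base_smooth
    F.flatSection F.flatSection_continuous F.flatSection_pt F.classify F.classify_denseRange
    F.algebraic_over_param F.pt₁

/-- **A spread family turns `t` into a CYCLE-INDUCED transcendental endomorphism** (van Geemen–Schütt's
`IsCycleInducedTranscendentalEndomorphism`, the shape of the tree's six vGS facts): given that `t`
preserves rational classes and Hodge types, kills `N¹H²(S)` and has image cup-orthogonal to it, an
`RMSpreadFamily S hS t` supplies the algebraic class inducing `t` (granted Voisin II Thm. 4.18).
[cite: GeemenSchutt2023, §4.8] [cite: VoisinHodgeII2003, Thm. 4.18 and §7.3.2] -/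
theorem isCycleInducedTranscendentalEndomorphism (hD : deligne1968_invariantClass_fromTotalSpace)
    (F : RMSpreadFamily S hS t)
    (ht_rat : ∀ y, IsRationalClass y → IsRationalClass (t y))
    (ht_typ : ∀ (i j : ℕ) (y : complexBetti S (2 * 1)),
      IsOfHodgeType 2 S (2 * 1) i j y → IsOfHodgeType 2 S (2 * 1) i j (t y))
    (ht_N : ∀ d ∈ algebraicClasses S 1, t d = 0)
    (ht_perp : ∀ (y : complexBetti S (2 * 1)), ∀ d ∈ algebraicClasses S 1,
      cupProduct (rfl : 2 * 1 + 2 * 1 = 2 * 2) (t y) d = 0) :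
    IsCycleInducedTranscendentalEndomorphism S hS t :=
  ⟨ht_rat, ht_typ, ht_N, ht_perp, F.exists_algebraicClass hD⟩

/-- **The spread family decides the Hodge conjecture for `S ⊗ S`** (line «maximal-family spread», final
kernel shape): for `t` rational, killing `N¹H²(S)` and GENERATING the rational Hodge endomorphisms of
`T(S)` (`TranscendentalEndomorphismsGeneratedBy S t`: `End_Hdg(T(S)_ℚ) = ℚ[t|_T]`), an `RMSpreadFamily S hS t`
gives `HodgeConjectureFor 4 (S ⊗ S)` — `t` is cycle-induced (`exists_algebraicClass`) and the tree's rung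
F4 `SquareOfGenerator.squareOfGenerator` (Varesco's bookkeeping over `ℚ[t]`) concludes. Conditional on
`deligne1968_invariantClass_fromTotalSpace` only. [cite: Varesco2023, §2 (p. 8)]
[cite: GeemenSchutt2023, §3.4 and §4.8] [cite: VoisinHodgeII2003, Thm. 4.18 and §7.3.2] -/
theorem hodgeConjectureFor_square (hD : deligne1968_invariantClass_fromTotalSpace)
    (F : RMSpreadFamily S hS t)
    (ht_rat : ∀ y, IsRationalClass y → IsRationalClass (t y))
    (ht_N : ∀ d ∈ algebraicClasses S 1, t d = 0)
    (hgen : TranscendentalEndomorphismsGeneratedBy S t) :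
    HodgeConjectureFor 4 (S ⊗ S) :=
  SquareOfGenerator.squareOfGenerator S hS t ht_rat ht_N (F.exists_algebraicClass hD) hgen

end RMSpreadFamily

/-- **Spread families turn RM K3 surfaces into cycle-induced RM K3 surfaces.** Let `S` be a K3 surface
with real multiplication by `ℚ[X]/(P)` of Picard number `ρ` (`IsRealMultiplicationK3 S ρ P`: not CM, and
some rational Hodge endomorphism `t` killing `N¹` with image `⊥ N¹`, `P(t) = 0` on `T`, generating
`End_Hdg(T)`). If EVERY such generator `t` admits a spread family, then `S` is an `IsCycleInducedRMK3 S ρ P`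
— a member of the cycle-induced sector of the crux (granted Voisin II Thm. 4.18).
[cite: GeemenSchutt2023, §2.1 and §4.8] [cite: VoisinHodgeII2003, Thm. 4.18 and §7.3.2] -/
theorem isCycleInducedRMK3_of_isRealMultiplicationK3_of_spreadFamilies
    (hD : deligne1968_invariantClass_fromTotalSpace) {ρ : ℕ} {P : ℚ[X]}
    (h : IsRealMultiplicationK3 S ρ P)
    (hF : ∀ t : complexBetti S (2 * 1) →ₗ[ℂ] complexBetti S (2 * 1),
      (∀ y, IsRationalClass y → IsRationalClass (t y)) →
      (∀ (i j : ℕ) (y : complexBetti S (2 * 1)),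
        IsOfHodgeType 2 S (2 * 1) i j y → IsOfHodgeType 2 S (2 * 1) i j (t y)) →
      (∀ d ∈ algebraicClasses S 1, t d = 0) →
      (∀ (y : complexBetti S (2 * 1)), ∀ d ∈ algebraicClasses S 1,
        cupProduct (rfl : 2 * 1 + 2 * 1 = 2 * 2) (t y) d = 0) →
      IsAnnihilatedOnTranscendentalBy S t P → TranscendentalEndomorphismsGeneratedBy S t →
      Nonempty (RMSpreadFamily S h.isK3Surface.isSmoothProjective t)) :
    IsCycleInducedRMK3 S ρ P := by
  obtain ⟨hK3, hρ, hCM, t, hrat, htyp, hN, hperp, hP, hgen⟩ := h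
  obtain ⟨F⟩ := hF t hrat htyp hN hperp hP hgen
  exact ⟨hK3, hρ, hCM, t, F.isCycleInducedTranscendentalEndomorphism hD hrat htyp hN hperp, hP, hgen⟩

/-- **The RM third at `S`, closed form** (INDEX row «RM-SPREAD» of cell hodge-nonav): a K3 surface with real
multiplication by `ℚ[X]/(P)` all of whose generators admit spread families satisfies the Hodge conjecture
for `S ⊗ S` — by `isCycleInducedRMK3_of_isRealMultiplicationK3_of_spreadFamilies` and the tree's UNCONDITIONAL
`SquareOfGenerator.hodgeConjectureFor_tensor_self_of_isCycleInducedRMK3`; conditional on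
`deligne1968_invariantClass_fromTotalSpace` only. With (I1′) the universal family over the RM component
through `S` carrying the generator as a flat section and (I2) a dominating cycle-carrying family
(van Geemen–Schütt's maximal families: Thm. 1.1 (9) at `ρ = 10`, cubic `ℚ(ζ₉+ζ₉⁻¹)`) the hypothesis
`hF` is met for every K3 surface of that component. [cite: GeemenSchutt2023, §3.4, Thm. 1.1 (9), §4.8, §5.6]
[cite: Varesco2023, §2 (p. 8)] [cite: VoisinHodgeII2003, Thm. 4.18 and §7.3.2] -/
theorem hodgeConjectureFor_square_of_isRealMultiplicationK3_of_spreadFamilies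
    (hD : deligne1968_invariantClass_fromTotalSpace) {ρ : ℕ} {P : ℚ[X]}
    (h : IsRealMultiplicationK3 S ρ P)
    (hF : ∀ t : complexBetti S (2 * 1) →ₗ[ℂ] complexBetti S (2 * 1),
      (∀ y, IsRationalClass y → IsRationalClass (t y)) →
      (∀ (i j : ℕ) (y : complexBetti S (2 * 1)),
        IsOfHodgeType 2 S (2 * 1) i j y → IsOfHodgeType 2 S (2 * 1) i j (t y)) →
      (∀ d ∈ algebraicClasses S 1, t d = 0) →
      (∀ (y : complexBetti S (2 * 1)), ∀ d ∈ algebraicClasses S 1,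
        cupProduct (rfl : 2 * 1 + 2 * 1 = 2 * 2) (t y) d = 0) →
      IsAnnihilatedOnTranscendentalBy S t P → TranscendentalEndomorphismsGeneratedBy S t →
      Nonempty (RMSpreadFamily S h.isK3Surface.isSmoothProjective t)) :
    HodgeConjectureFor 4 (S ⊗ S) :=
  SquareOfGenerator.hodgeConjectureFor_tensor_self_of_isCycleInducedRMK3
    (isCycleInducedRMK3_of_isRealMultiplicationK3_of_spreadFamilies hD h hF)


/-! ### Unconditional forms (appended): Voisin II Thm. 4.18 is a theorem of the tree

The one named fact consumed above, `deligne1968_invariantClass_fromTotalSpace`, is DISCHARGED in the tree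
(`deligne1968_invariantClass_fromTotalSpace_holds`, `InvariantClassesFromTotalSpaceHolds.lean`; referee
hodge-nonav-ref g57 n-S1). Hence the closed form of the row «RM-SPREAD» carries NO named fact: the Hodge
conjecture for the square of an RM K3 surface follows from the EXISTENCE of a spread family for its
generator alone — inputs (I1′) + (I2) of the crux idea, displayed as `RMSpreadFamily`. -/

namespace RMSpreadFamily

/-- **`t` is induced by an algebraic class on `S × S` — UNCONDITIONAL** (`exists_algebraicClass` with the
tree's `deligne1968_invariantClass_fromTotalSpace_holds`). [cite: VoisinHodgeII2003, Thm. 4.18 and §7.3.2]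
[cite: GeemenSchutt2023, §4.8] -/
theorem exists_algebraicClass' (F : RMSpreadFamily S hS t) :
    ∃ γ ∈ algebraicClasses (S ⊗ S) 2, ∀ y : complexBetti S (2 * 1),
      t y = complexGysin complexOrientationFamily (IsSmoothProjective.tensor_holds hS hS) hS
        (SemiCartesianMonoidalCategory.fst S S) (rfl : 2 * 1 + 2 * 2 + 2 * 2 = 2 * 1 + 2 * (2 + 2))
        (cupProduct (rfl : 2 * 1 + 2 * 2 = 2 * 1 + 2 * 2)
          (complexBetti.map (SemiCartesianMonoidalCategory.snd S S) (2 * 1) y) γ) :=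
  F.exists_algebraicClass deligne1968_invariantClass_fromTotalSpace_holds

/-- **A spread family turns `t` into a cycle-induced transcendental endomorphism — UNCONDITIONAL.**
[cite: GeemenSchutt2023, §4.8] [cite: VoisinHodgeII2003, Thm. 4.18 and §7.3.2] -/
theorem isCycleInducedTranscendentalEndomorphism' (F : RMSpreadFamily S hS t)
    (ht_rat : ∀ y, IsRationalClass y → IsRationalClass (t y))
    (ht_typ : ∀ (i j : ℕ) (y : complexBetti S (2 * 1)),
      IsOfHodgeType 2 S (2 * 1) i j y → IsOfHodgeType 2 S (2 * 1) i j (t y))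
    (ht_N : ∀ d ∈ algebraicClasses S 1, t d = 0)
    (ht_perp : ∀ (y : complexBetti S (2 * 1)), ∀ d ∈ algebraicClasses S 1,
      cupProduct (rfl : 2 * 1 + 2 * 1 = 2 * 2) (t y) d = 0) :
    IsCycleInducedTranscendentalEndomorphism S hS t :=
  F.isCycleInducedTranscendentalEndomorphism deligne1968_invariantClass_fromTotalSpace_holds
    ht_rat ht_typ ht_N ht_perp

/-- **The spread family decides the Hodge conjecture for `S ⊗ S` — UNCONDITIONAL in the tree** (no named
fact; the only hypotheses are the spread family and the generator clauses). [cite: Varesco2023, §2 (p. 8)]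
[cite: GeemenSchutt2023, §3.4 and §4.8] [cite: VoisinHodgeII2003, Thm. 4.18 and §7.3.2] -/
theorem hodgeConjectureFor_square' (F : RMSpreadFamily S hS t)
    (ht_rat : ∀ y, IsRationalClass y → IsRationalClass (t y))
    (ht_N : ∀ d ∈ algebraicClasses S 1, t d = 0)
    (hgen : TranscendentalEndomorphismsGeneratedBy S t) :
    HodgeConjectureFor 4 (S ⊗ S) :=
  F.hodgeConjectureFor_square deligne1968_invariantClass_fromTotalSpace_holds ht_rat ht_N hgen

end RMSpreadFamily

/-- **Spread families turn RM K3 surfaces into cycle-induced RM K3 surfaces — UNCONDITIONAL.**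
[cite: GeemenSchutt2023, §2.1 and §4.8] [cite: VoisinHodgeII2003, Thm. 4.18 and §7.3.2] -/
theorem isCycleInducedRMK3_of_isRealMultiplicationK3_of_spreadFamilies' {ρ : ℕ} {P : ℚ[X]}
    (h : IsRealMultiplicationK3 S ρ P)
    (hF : ∀ t : complexBetti S (2 * 1) →ₗ[ℂ] complexBetti S (2 * 1),
      (∀ y, IsRationalClass y → IsRationalClass (t y)) →
      (∀ (i j : ℕ) (y : complexBetti S (2 * 1)),
        IsOfHodgeType 2 S (2 * 1) i j y → IsOfHodgeType 2 S (2 * 1) i j (t y)) →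
      (∀ d ∈ algebraicClasses S 1, t d = 0) →
      (∀ (y : complexBetti S (2 * 1)), ∀ d ∈ algebraicClasses S 1,
        cupProduct (rfl : 2 * 1 + 2 * 1 = 2 * 2) (t y) d = 0) →
      IsAnnihilatedOnTranscendentalBy S t P → TranscendentalEndomorphismsGeneratedBy S t →
      Nonempty (RMSpreadFamily S h.isK3Surface.isSmoothProjective t)) :
    IsCycleInducedRMK3 S ρ P :=
  isCycleInducedRMK3_of_isRealMultiplicationK3_of_spreadFamilies
    deligne1968_invariantClass_fromTotalSpace_holds h hF

/-- **Row «RM-SPREAD», closed form — UNCONDITIONAL in the tree**: a K3 surface with real multiplication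
by `ℚ[X]/(P)` all of whose generators admit spread families satisfies `HodgeConjectureFor 4 (S ⊗ S)`; no
named fact remains (Voisin II Thm. 4.18 = `deligne1968_invariantClass_fromTotalSpace_holds`), so the open
inputs of the line «maximal-family spread» are exactly (I1′) the universal RM-component family with flat
generator and (I2) a dominating cycle-carrying family. [cite: GeemenSchutt2023, §3.4, Thm. 1.1 (9), §4.8]
[cite: Varesco2023, §2 (p. 8)] [cite: VoisinHodgeII2003, Thm. 4.18 and §7.3.2] -/
theorem hodgeConjectureFor_square_of_isRealMultiplicationK3_of_spreadFamilies' {ρ : ℕ} {P : ℚ[X]}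
    (h : IsRealMultiplicationK3 S ρ P)
    (hF : ∀ t : complexBetti S (2 * 1) →ₗ[ℂ] complexBetti S (2 * 1),
      (∀ y, IsRationalClass y → IsRationalClass (t y)) →
      (∀ (i j : ℕ) (y : complexBetti S (2 * 1)),
        IsOfHodgeType 2 S (2 * 1) i j y → IsOfHodgeType 2 S (2 * 1) i j (t y)) →
      (∀ d ∈ algebraicClasses S 1, t d = 0) →
      (∀ (y : complexBetti S (2 * 1)), ∀ d ∈ algebraicClasses S 1,
        cupProduct (rfl : 2 * 1 + 2 * 1 = 2 * 2) (t y) d = 0) →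
      IsAnnihilatedOnTranscendentalBy S t P → TranscendentalEndomorphismsGeneratedBy S t →
      Nonempty (RMSpreadFamily S h.isK3Surface.isSmoothProjective t)) :
    HodgeConjectureFor 4 (S ⊗ S) :=
  hodgeConjectureFor_square_of_isRealMultiplicationK3_of_spreadFamilies
    deligne1968_invariantClass_fromTotalSpace_holds h hF

end Summit.HodgeConjecture.HodgeConjecture.Theorems.MarkmanPartnerTransport
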